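import Summits.QuantumFields.YangMills.Theorems.BalabanUVNodesK3V6Defs
import Summits.QuantumFields.YangMills.Theorems.BalabanUVNodesN21GappedTopPairReading13CoPHDefs

/-!
# K3⁸ v7 — THE PAIR GAP PIN `PinnedAtLiveGap2`, THE DIAL ROWS `DialRows`, AND THE BY-NAME COMPOSITION OF THE TWO v7 STUB TEXTS ONTO THE ROUTE DECL —
# the tree MIRROR of skeleton v7's two new §1 texts over `…K3V5Defs` ∕ `…K3V6Defs` (pattern of dag-n27-w1's `K3V5Defs` p606160 ∕ `K3V6Defs`), so that stub-2 shares can be filed BY NAME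

R134 seat `pub-ymgap-dag-n21-d` (g17, lane owner N21), `--supports stmt-QuantumFields-27366 --as helper` (count-neutral).  v7 = director-ym №238 (I.≈43700, 2026-08-28T22:53Z): ONE re-cut of
K3⁸ `SpineGivenEndpointR13SepCoPHV` (stmt-QuantumFields-27366) from the banked candidate kit `K3Skeleton13SepCoPHv7candidate.lean` (evidence #47, 810d808c8ef1603e) = v6 b4e55110ab73e679 with
EXACTLY the stub-2 pin substitution `∃ jc sh cr, PinnedAtLive jc sh cr ∧ …` ↦ `∃ jc ρ ρ′ n₁ n₂ cr, PinnedAtLiveGap2 jc ρ ρ′ n₁ n₂ cr ∧ DialRows ρ ρ′ n₁ n₂ ∧ …` (stub names, stub 1, guard,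
rates and the four faces byte-identical; composition unchanged but for one more discarded conjunct).  v5's §1 texts (`K3V5Defs`) and v6's §1V faces (`K3V6Defs`) are REUSED BY NAME —
nothing re-declared.  THIS FILE puts the two new texts into the tree VERBATIM (kit :506 ∕ :513 = the lane's probe #46 §1) and, as §2, the by-name composition of the two v7 stub TEXTS
onto K3⁸ (= the kit's `SpineGivenEndpointR13SepCoPHV_of`: the pin and the dial rows are discarded exactly as v6 discards its pin, then `K3V6Defs.spineGivenEndpointR13SepCoPHV_of_facesV`).

CONTENTS.  §1 `PinnedAtLiveGap2` · `DialRows` (v7 kit texts VERBATIM).  §2 `spineGivenEndpointR13SepCoPHV_of_stubTextsV7` (the two v7 texts ⟹ K3⁸ BY NAME) ·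
`spineGivenEndpointR13SepCoPHV_of_ratesV_of_stub2BodyV7` (K4 at one `(β, rr)` + the v7 stub-2 BODY at that `(β, rr)` ⟹ K3⁸) · `pinnedAtLiveGap2_of_eq` (a reading that IS the
doubly-gapped reading on the live line is so pinned).

HONEST FRAMING.  Two definitions (texts mirrored from the kit), by-name compositions (pure logic over `K3V6Defs`); no estimate; no stub of v7 (or v6) is proved or claimed here; the
pin's reading `crGap2₁₃V` is dag-n21-w7's ∕ this lane's `…N21GappedTopPair13CoPH` object; NOTHING of Bałaban asserted or instantiated; N19′ ∕ N20 ∕ N21 ∕ N27 NOT discharged;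
K3⁸ OPEN · unclaimed (skeleton of record = whatever the plan registers — this file neither replaces nor registers it; if the registered v7 texts differ from the kit's, this file is
superseded, not edited); counts unmoved (typed 28∕28 · discharged 6∕28, display 6∕27).  One finite 𝕋⁴ programme at fixed `ε` — NOT continuum ∕ ℝ⁴ ∕ OS ∕ mass gap ∕ Clay.
No `sorry`, `instance`, `notation`; standard axioms.
-/

set_option autoImplicit false

noncomputable section

namespace Summit.QuantumFields.YangMills.Theorems.K3V7Defs

open Literature.MathematicalPhysics.QuantumFieldTheory.Balaban1983to89
open Literature.MathematicalPhysics.QuantumFieldTheory.Balaban1983to89.T4Continuum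
open Literature.MathematicalPhysics.QuantumFieldTheory.Balaban1983to89.Node00
open YMDAG.UVSplit (RateReading₁₃CoPH)
open Summit.QuantumFields.YangMills.Theorems.K3V5Defs (SpineReading RateReadingFn RunSel LetterReading CutReading rrOfRecord GuardedReadingN16 KeyedRelWeight KeyedShellWeight
  LiveSel)
open Summit.QuantumFields.YangMills.Theorems.K3V6Defs (KeyedRatesHolderD4V KeyedCoreEdgeHolderD4V KeyedExtractionV spineGivenEndpointR13SepCoPHV_of_facesV)
open Summit.QuantumFields.YangMills.Theorems.N21ShellSplitOfRecord13CoPH (WidthLetter₁₃CoPH DepthLetter₁₃CoPH)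
open Summit.QuantumFields.YangMills.Theorems.N21GappedTopPair13CoPH (crGap2₁₃V)

/-! ## §1 (v7) The pair gap pin and the dial rows — kit texts VERBATIM -/

/-- **PINNED AT LIVE, GAPPED (pair form)** — v6's `PinnedAtLive jc sh cr` with the reading of record `crOfRecord₁₃V (jc …) sh` replaced by dag-n21-w7's DOUBLY-GAPPED reading
`crGap2₁₃V 2 (jc …) ρ ρ′ n₁ n₂` — the top step's (3.2) indicator family gapped at the selected letter of the grid `ε(1−ρ)^i` (depth `n₁`) AND its (3.3) family at the grid of `ρ′`
(depth `n₂`); index, class set, bad class `badClass₁₃ θ 0 g₀ (jc …)`, `l₀ = 1`, `vol = F.side⁴`, canonical `W ∕ Wsh ∕ δ` exactly as `crOfRecord₁₃V`.  Width letters `ρ ρ′` and depth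
letters `n₁ n₂` are READ PER TUPLE like `jc`; off the live line the reading is free. [cite: Balaban1989LargeFieldI, p.181 (the regularity thresholds may be changed by a factor; bookkeeping)] -/
def PinnedAtLiveGap2 (jc : CutReading) (ρ ρ' : WidthLetter₁₃CoPH 2) (n₁ n₂ : DepthLetter₁₃CoPH 2) (cr : SpineReading) : Prop :=
  ∀ (F : T4Family) (θ : Stage13HParams F 2) (hP : θ.Provisos₁₃CoPH F 2) (g₀ : ℕ → ℝ) (os : List (ULoop F)),
    LiveSel F θ → cr F θ hP g₀ os = crGap2₁₃V 2 (jc F θ hP g₀ os) ρ ρ' n₁ n₂ F θ hP g₀ os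

/-- **THE DIAL ROWS**: widths in `[0, 1]`, depths with `Σ_K (1∕(n₁ K + 1) + 1∕(n₂ K + 1)) < ∞`, at every tuple — the two rows every gapped face file displays (dag-n21-w7
`shellWeightBound_crGap2₁₃VAt_signFree`, this lane's V3 ∕ V8 ∕ ζ1, dag-n21-w2 `…KnitOfCloseness`, which PRODUCES the dials from one closeness letter per indicator family).  Conjoined to the
pin so that the dials are the PROVER's and their rows VISIBLE. [bookkeeping] -/
def DialRows (ρ ρ' : WidthLetter₁₃CoPH 2) (n₁ n₂ : DepthLetter₁₃CoPH 2) : Prop :=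
  (∀ (F : T4Family) (θ : Stage13HParams F 2) (hP : θ.Provisos₁₃CoPH F 2) (g₀ : ℕ → ℝ) (os : List (ULoop F)) (K : ℕ),
      (0 ≤ ρ F θ hP g₀ os K ∧ ρ F θ hP g₀ os K ≤ 1) ∧ (0 ≤ ρ' F θ hP g₀ os K ∧ ρ' F θ hP g₀ os K ≤ 1)) ∧
  (∀ (F : T4Family) (θ : Stage13HParams F 2) (hP : θ.Provisos₁₃CoPH F 2) (g₀ : ℕ → ℝ) (os : List (ULoop F)),
      Summable (fun K => 1 / ((n₁ F θ hP g₀ os K : ℝ) + 1) + 1 / ((n₂ F θ hP g₀ os K : ℝ) + 1)))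

/-- A reading that IS the doubly-gapped reading on the live line (whatever it is off the line) is pinned — the witness shape of every pair-road knit (`hon`). [bookkeeping] -/
theorem pinnedAtLiveGap2_of_eq (jc : CutReading) (ρ ρ' : WidthLetter₁₃CoPH 2) (n₁ n₂ : DepthLetter₁₃CoPH 2) {cr : SpineReading}
    (hon : ∀ (F : T4Family) (θ : Stage13HParams F 2) (hP : θ.Provisos₁₃CoPH F 2) (g₀ : ℕ → ℝ) (os : List (ULoop F)),
      LiveSel F θ → cr F θ hP g₀ os = crGap2₁₃V 2 (jc F θ hP g₀ os) ρ ρ' n₁ n₂ F θ hP g₀ os) :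
    PinnedAtLiveGap2 jc ρ ρ' n₁ n₂ cr :=
  hon

/-- The two dial rows, separately stated, give `DialRows` (`And.intro`). [bookkeeping] -/
theorem dialRows_of_rows (ρ ρ' : WidthLetter₁₃CoPH 2) (n₁ n₂ : DepthLetter₁₃CoPH 2)
    (hρ : ∀ (F : T4Family) (θ : Stage13HParams F 2) (hP : θ.Provisos₁₃CoPH F 2) (g₀ : ℕ → ℝ) (os : List (ULoop F)) (K : ℕ),
      (0 ≤ ρ F θ hP g₀ os K ∧ ρ F θ hP g₀ os K ≤ 1) ∧ (0 ≤ ρ' F θ hP g₀ os K ∧ ρ' F θ hP g₀ os K ≤ 1))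
    (hn : ∀ (F : T4Family) (θ : Stage13HParams F 2) (hP : θ.Provisos₁₃CoPH F 2) (g₀ : ℕ → ℝ) (os : List (ULoop F)),
      Summable (fun K => 1 / ((n₁ F θ hP g₀ os K : ℝ) + 1) + 1 / ((n₂ F θ hP g₀ os K : ℝ) + 1))) :
    DialRows ρ ρ' n₁ n₂ :=
  ⟨hρ, hn⟩

/-! ## §2 The by-name composition of the two v7 stub texts onto K3⁸ (= the kit's `SpineGivenEndpointR13SepCoPHV_of`) -/

/-- ★ **THE TWO v7 STUB TEXTS ⟹ K3⁸, BY NAME**: `h₁` = stub 1's text (`stub_rates13HV`, v6 = v7), `h₂` = stub 2's v7 text (`stub_expansion13HV` with the pair gap pin and the dial rows);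
the pin and the dial rows are discarded exactly as v6's composition discards its pin, then `K3V6Defs.spineGivenEndpointR13SepCoPHV_of_facesV`.  Pure logic; nothing inhabited. [bookkeeping] -/
theorem spineGivenEndpointR13SepCoPHV_of_stubTextsV7
    (h₁ : ∃ β : ℝ, 2 / 3 < β ∧ β < 1 ∧
      ∃ (𝔯 : RateReading₁₃CoPH 2) (ksel : RunSel) (ℓ : LetterReading) (ℓ₃ : T4Family → Node00.NE3Letters₁₁) (g B : T4Family → ℝ),
        GuardedReadingN16 𝔯 ksel ℓ ℓ₃ g B ∧ KeyedRatesHolderD4V β (rrOfRecord 𝔯 ksel))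
    (h₂ : ∀ β : ℝ, 2 / 3 < β → β < 1 →
      ∀ (𝔯 : RateReading₁₃CoPH 2) (ksel : RunSel) (ℓ : LetterReading) (ℓ₃ : T4Family → Node00.NE3Letters₁₁) (g B : T4Family → ℝ),
        GuardedReadingN16 𝔯 ksel ℓ ℓ₃ g B → KeyedRatesHolderD4V β (rrOfRecord 𝔯 ksel) →
        ∃ (jc : CutReading) (ρ ρ' : WidthLetter₁₃CoPH 2) (n₁ n₂ : DepthLetter₁₃CoPH 2) (cr : SpineReading), PinnedAtLiveGap2 jc ρ ρ' n₁ n₂ cr ∧ DialRows ρ ρ' n₁ n₂ ∧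
          KeyedRelWeight cr ∧ KeyedShellWeight cr ∧ KeyedExtractionV cr ∧ KeyedCoreEdgeHolderD4V β cr (rrOfRecord 𝔯 ksel)) :
    Summit.QuantumFields.YangMills.Theses.BalabanUVNodes.SpineGivenEndpointR13SepCoPHV := by
  obtain ⟨β, hβ, hβ', 𝔯, ksel, ℓ, ℓ₃, g, B, hg, hr⟩ := h₁
  obtain ⟨_jc, _ρ, _ρ', _n₁, _n₂, cr, -, -, h20, h21, hx, h19⟩ := h₂ β hβ hβ' 𝔯 ksel ℓ ℓ₃ g B hg hr
  exact spineGivenEndpointR13SepCoPHV_of_facesV β cr (rrOfRecord 𝔯 ksel) h20 h21 hr h19 hx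

/-- ★ **K4 AT ONE `(β, rr)` + THE v7 STUB-2 BODY AT THAT `(β, rr)` ⟹ K3⁸** (no stub-1 guard is read by the composition). [bookkeeping] -/
theorem spineGivenEndpointR13SepCoPHV_of_ratesV_of_stub2BodyV7 (β : ℝ) (rr : RateReadingFn) (hr : KeyedRatesHolderD4V β rr)
    (h₂ : ∃ (jc : CutReading) (ρ ρ' : WidthLetter₁₃CoPH 2) (n₁ n₂ : DepthLetter₁₃CoPH 2) (cr : SpineReading), PinnedAtLiveGap2 jc ρ ρ' n₁ n₂ cr ∧ DialRows ρ ρ' n₁ n₂ ∧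
      KeyedRelWeight cr ∧ KeyedShellWeight cr ∧ KeyedExtractionV cr ∧ KeyedCoreEdgeHolderD4V β cr rr) :
    Summit.QuantumFields.YangMills.Theses.BalabanUVNodes.SpineGivenEndpointR13SepCoPHV := by
  obtain ⟨_jc, _ρ, _ρ', _n₁, _n₂, cr, -, -, h20, h21, hx, h19⟩ := h₂
  exact spineGivenEndpointR13SepCoPHV_of_facesV β cr rr h20 h21 hr h19 hx

end Summit.QuantumFields.YangMills.Theorems.K3V7Defs

end
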